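import Summits.Langlands.Langlands.Statement
import Literature.NumberTheory.Automorphic.FontaineMazurGL2WeightOne
import Literature.NumberTheory.GaloisRepresentations.EvenGaloisRep
import HarnessLib
/-!
# `ArtinWeightFMAllParitiesQ2` — F3 SPECIAL-CASE WITNESS (generation 17 on `ReciprocityUpToIrreducibility`, item stmt-Langlands-14328)

The rung family `ArtinWeightFM θ` (parity dial at Artin weight, infinite-image sector, `GL₂/ℚ`, `p` odd), its cells,
THE RUNG `ArtinWeightFMAllParitiesQ2 := ArtinWeightFM 2`, the PROVED parity dichotomy `isOdd_or_isEven` and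
`rung_of_cells`, and the FLOOR THEOREM `floor_zero : Pan2022_fontaineMazurGL2_weightOne → ArtinWeightFM 0` with the
F3 instance `example (h : Pan2022_fontaineMazurGL2_weightOne) : ArtinWeightFM 0 := by simpa using floor_zero h`
(the family at the floor parameter IS the landed named fact, Pan 2022 Thm. 1.0.5; the rung specialises to it:
`oddCell_of_rung`).  No `sorry`.
-/
noncomputable section

set_option linter.dupNamespace false

open scoped MatrixGroups Matrix NumberField Classical
open NumberField IsDedekindDomain Field Filter
open Literature.NumberTheory.Automorphic Literature.NumberTheory.GaloisRepresentations
open Literature.NumberTheory.PAdicHodge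
open Summit.Langlands

namespace Summit.Langlands.Langlands.Cruxes.ReciprocityUpToIrreducibility.ArtinWeightFMAllParitiesQ2

/-! ## The family, its cells and the rung -/

/-- **The rung family** `E(θ)` — PARITY `θ` of the Artin-weight (Hodge–Tate `(0,0)`) Fontaine–Mazur
statement for `GL₂` over `ℚ` in the INFINITE-IMAGE sector: for every odd prime `p` and every continuous,
a.e. unramified, irreducible `ρ : Γ_ℚ → GL₂(ℚ̄_p)` with `ρ̄|Γ_{ℚ(ζ_p)}` absolutely irreducible (TW),
residually generic at `p` (GEN), de Rham at `p` of labelled Hodge–Tate weights `{0,0}` (equivalently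
potentially unramified at `p`, Sen) and with INFINITE image, subject to the parity clause
`θ = 0 → ρ` odd, `θ = 1 → ρ` even (`θ ≥ 2`: no parity clause), there is an `L`-algebraic cuspidal `π`
of `GL₂(𝔸_ℚ)` attached to `ρ` at almost all places.  `θ = 0`: Pan 2022 Thm. 1.0.5 (FLOOR cell, in the
tree); `θ = 1`: the EVEN cell (open: the even case of the unramified Fontaine–Mazur conjecture,
Fontaine–Mazur Conj. 5a, at Taylor–Wiles level); `θ = 2`: THE RUNG (no parity clause = both cells).
[cite: Pan2022LocallyAnalytic, Thm. 1.0.5] [cite: AllenCalegari2014, Thm. 1, Cor. 2, Cor. 3]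
[cite: FontaineMazur1995, Conj. 5a] -/
def ArtinWeightFM (θ : ℕ) : Prop :=
  ∀ (p : ℕ) [Fact p.Prime], p ≠ 2 →
    ∀ (ρ : FramedGaloisRep ℚ (PadicAlgCl p) 2),
      (∀ᶠ v : HeightOneSpectrum (𝓞 ℚ) in cofinite, ρ.IsUnramifiedAt v) →
      ρ.toGaloisRep.IsIrreducible →
      (θ = 0 → ρ.IsOdd) →
      (θ = 1 → ρ.IsEven) →
      (ρ.restrictField (CyclotomicField p ℚ)).IsResiduallyAbsIrreducible →
      (∀ v : HeightOneSpectrum (𝓞 ℚ), ((p : ℕ) : 𝓞 ℚ) ∈ v.asIdeal → IsResiduallyGenericGL2At ρ v) →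
      IsDeRhamWeightZeroGL2 p ρ →
      (Set.range ⇑ρ).Infinite →
      ∀ (hcpt : isCompact_glFiniteIntegralLevel 2 ℚ) (ι : PadicAlgCl p ≃+* ℂ),
        ∃ π : CuspidalAutomorphicRepData 2 ℚ hcpt, π.1.IsLAlgebraic ∧ SatakeFrobCompatibleAE ι π.1 ρ

/-- The ODD cell `E(0)` (the floor instance of the family: Pan 2022 Thm. 1.0.5 restricted to infinite image). -/
def OddArtinWeightInfiniteImageQ2 : Prop := ArtinWeightFM 0

/-- The EVEN cell `E(1)` — the open core of the rung: every irreducible, a.e. unramified, EVEN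
`ρ : Γ_ℚ → GL₂(ℚ̄_p)` (`p` odd) that is de Rham of Hodge–Tate weights `(0,0)` at `p`, has infinite image
and satisfies (TW) and (GEN) is automorphic (conjecturally this sector is EMPTY: Fontaine–Mazur 5a). -/
def EvenArtinWeightInfiniteImageQ2 : Prop := ArtinWeightFM 1

/-- **THE RUNG** (the filed statement): the family at `θ = 2` — the Artin-weight Fontaine–Mazur
statement for `GL₂/ℚ` in the infinite-image sector with NO PARITY HYPOTHESIS (Pan's theorem with "odd"
deleted). -/
def ArtinWeightFMAllParitiesQ2 : Prop := ArtinWeightFM 2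

/-! ## Dial structure (all sorry-free) -/

/-- The rung implies every cell (adding a parity clause only weakens). -/
theorem of_rung (θ : ℕ) (h : ArtinWeightFMAllParitiesQ2) : ArtinWeightFM θ := by
  intro p _ hp ρ hunr hirr _hodd _heven htw hgen hdr hinf hcpt ι
  exact h p hp ρ hunr hirr (fun h0 => absurd h0 (by norm_num)) (fun h1 => absurd h1 (by norm_num))
    htw hgen hdr hinf hcpt ι

/-- All parameters `θ ≥ 2` give the same statement (no parity clause fires). -/
theorem eq_rung {θ : ℕ} (hθ : 2 ≤ θ) : ArtinWeightFM θ ↔ ArtinWeightFMAllParitiesQ2 := by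
  refine ⟨fun h => ?_, of_rung θ⟩
  intro p _ hp ρ hunr hirr _hodd _heven htw hgen hdr hinf hcpt ι
  exact h p hp ρ hunr hirr (fun h0 => absurd h0 (by omega)) (fun h1 => absurd h1 (by omega))
    htw hgen hdr hinf hcpt ι

/-- The rung specialises to the floor cell. -/
@[aesop safe apply]
theorem oddCell_of_rung (h : ArtinWeightFMAllParitiesQ2) : ArtinWeightFM 0 := of_rung 0 h

/-- The rung contains the even cell. -/
theorem evenCell_of_rung (h : ArtinWeightFMAllParitiesQ2) : EvenArtinWeightInfiniteImageQ2 := of_rung 1 h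

/-- **Parity dichotomy over `ℚ` in rank two**: a framed `ρ : Γ_ℚ → GL₂(ℚ̄_p)` is odd or even.  All
complex conjugations of `Γ_ℚ` (for the unique real embedding) are conjugate
(`IsComplexConjugation.isConj`), so `det ρ(c)` does not depend on `c`, and `det ρ(c)² = 1` in the field
`ℚ̄_p` forces `det ρ(c) = ±1`. [folklore] -/
theorem isOdd_or_isEven {p : ℕ} [Fact p.Prime] (ρ : FramedGaloisRep ℚ (PadicAlgCl p) 2) :
    ρ.IsOdd ∨ ρ.IsEven := by
  obtain ⟨c₀, hc₀⟩ := exists_isComplexConjugation (Rat.castHom ℝ)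
  -- `det ρ(c)` is the same at every complex conjugation `c`
  have hconst : ∀ (φ : ℚ →+* ℝ) (c : absoluteGaloisGroup ℚ), IsComplexConjugation φ c →
      Matrix.GeneralLinearGroup.det (ρ c) = Matrix.GeneralLinearGroup.det (ρ c₀) := by
    intro φ c hc
    obtain rfl : φ = Rat.castHom ℝ := Subsingleton.elim _ _
    obtain ⟨u, hu⟩ := hc₀.isConj hc
    have hc' : c = (u : absoluteGaloisGroup ℚ) * c₀ * (u : absoluteGaloisGroup ℚ)⁻¹ := by
      rw [hu.eq, mul_inv_cancel_right]
    rw [hc', map_mul, map_mul, map_inv, map_mul, map_mul, map_inv, mul_inv_eq_iff_eq_mul, mul_comm]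
  -- `det ρ(c₀) = ±1`
  have hsq := ρ.det_sq_eq_one_of_isComplexConjugation hc₀
  have hval : ((Matrix.GeneralLinearGroup.det (ρ c₀) : (PadicAlgCl p)ˣ) : PadicAlgCl p) *
      (Matrix.GeneralLinearGroup.det (ρ c₀) : PadicAlgCl p) = 1 := by
    rw [← Units.val_mul, ← sq, hsq, Units.val_one]
  rcases mul_self_eq_one_iff.mp hval with h1 | h1
  · right
    intro φ c hc
    rw [hconst φ c hc]
    exact Units.ext (by rw [h1, Units.val_one])
  · left
    intro φ c hc
    rw [hconst φ c hc]
    exact Units.ext (by rw [h1, Units.val_neg, Units.val_one])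

/-- **The rung from its two cells** (the load-bearing split): the odd cell (floor) and the even cell
together give the parity-free statement, by the parity dichotomy. -/
theorem rung_of_cells (hodd : ArtinWeightFM 0) (heven : EvenArtinWeightInfiniteImageQ2) :
    ArtinWeightFMAllParitiesQ2 := by
  intro p _ hp ρ hunr hirr _h0 _h1 htw hgen hdr hinf hcpt ι
  rcases isOdd_or_isEven ρ with hpar | hpar
  · exact hodd p hp ρ hunr hirr (fun _ => hpar) (fun h => absurd h (by norm_num)) htw hgen hdr hinf hcpt ι
  · exact heven p hp ρ hunr hirr (fun h => absurd h (by norm_num)) (fun _ => hpar) htw hgen hdr hinf hcpt ι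

/-- The rung is EQUIVALENT to the conjunction of its two cells. -/
theorem rung_iff_cells : ArtinWeightFMAllParitiesQ2 ↔ ArtinWeightFM 0 ∧ EvenArtinWeightInfiniteImageQ2 :=
  ⟨fun h => ⟨oddCell_of_rung h, evenCell_of_rung h⟩, fun h => rung_of_cells h.1 h.2⟩

/-! ## F3 — the floor: Pan 2022 Thm. 1.0.5 is the odd cell -/

/-- **FLOOR THEOREM** (F3 special-case witness): the landed named fact
`Pan2022_fontaineMazurGL2_weightOne` (Pan, Forum Math. Pi 10 (2022), Thm. 1.0.5) gives the family at
`θ = 0` — the infinite-image hypothesis is simply not used. No `sorry`. -/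
theorem floor_zero (h : Pan2022_fontaineMazurGL2_weightOne) : ArtinWeightFM 0 := by
  intro p _ hp ρ hunr hirr hodd _heven htw hgen hdr _hinf hcpt ι
  exact h p hp ρ hunr hirr (hodd rfl) htw hgen hdr hcpt ι

/-- F3 special-case instance: the family at the floor parameter IS the floor (modulo the floor's
in-tree named fact, exactly as the tree holds it). -/
example (h : Pan2022_fontaineMazurGL2_weightOne) : ArtinWeightFM 0 := by
  simpa using floor_zero h

/-- Given the floor, the rung is EXACTLY the even cell. -/
theorem rung_iff_evenCell_of_floor (h : Pan2022_fontaineMazurGL2_weightOne) :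
    ArtinWeightFMAllParitiesQ2 ↔ EvenArtinWeightInfiniteImageQ2 :=
  ⟨evenCell_of_rung, rung_of_cells (floor_zero h)⟩

end Summit.Langlands.Langlands.Cruxes.ReciprocityUpToIrreducibility.ArtinWeightFMAllParitiesQ2

end
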